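import Mathlib
import Literature.Analysis.FluidPDE.VectorCalculus
import Summits.NavierStokesRegularity.NavierStokesRegularity.Theorems.UnthreadedDoorKinematicShadowPointSourceDipole
import HarnessLib

/-!
# Crux `PoloidalLiouville` (stmt-NavierStokesRegularity-1222, W1), crux idea «kinematic-shadow» (ns-idea-15 g6):
# the point-source dipole as an ETERNAL solution — the ancient kinematic shadow is false on the punctured space

Support file (`--supports stmt-NavierStokesRegularity-1222`, helper), third of the point-source dipole series
(`…PointSourceCalculus`, `…PointSourceDipole`).  Experiment cell `ns-wall-extremal`, width hand ns-wall-eng-5 g6.  0 kit.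

The time-independent pair (point source `u(x) = x/‖x‖³`, dipole potential `T(x) = ⟪e,x⟫Φ(‖x‖)`) of
`KinematicShadow.pointSourceDipole` is an ETERNAL solution of the time-dependent kinematic law (E1)
`∇(∂ₜT + ⟪u,∇T⟫ − ΔT) × (x − x₀) = ∇⟪u, · − x₀⟫ × ∇T` — the body of the sketch's `KinematicLaw u T x₀`
(`Cruxes/PoloidalLiouville/KinematicShadowSketch.lean` l.64) — on `(−∞,0) × (E ∖ {0})`.  Hence

* `KinematicShadow.kinematicShadowAncient_false_without_centre` — **the sketch's `KinematicShadowAncient` (l.151; the form that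
  maps to the wall via `wallShape_of_kinematicShadowAncient`) with its three DRIFT binders `IsBoundedOn (Iio 0) u`,
  `∀ t < 0, IsWeaklyDivFree (u t)`, `ContDiffOn ℝ ⊤ (uncurry u) (Iio 0 ×ˢ univ)` weakened to the punctured space —
  `u` jointly smooth on `(−∞,0) × {x₀}ᶜ`, `div (u t) = 0` off `x₀`, `‖u t x‖ ≤ K/‖x − x₀‖²` — and every other binder
  (`T` jointly smooth on `(−∞,0) × {x₀}ᶜ`, `|T| ≤ C`, `‖∇T × (x − x₀)‖ ≤ C`, the law) and the conclusion VERBATIM, is FALSE.**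

READING as in the steady file: the drift's regularity AT the centre is what the (linear) shadow must use.  HONEST FRAME: explicit
solution of a linear kinematic system; `KinematicShadowAncient`, the wall `stub_scalarLiouville`, `PoloidalLiouville` (1222) and
NS regularity are untouched and OPEN.
-/

-- the summit and its single problem share the name (D-0017 nested layout)
set_option linter.dupNamespace false

noncomputable section

namespace Summit.NavierStokesRegularity.NavierStokesRegularity.Theorems.PoloidalLiouville.KinematicShadow

open Set Function Filter Topology Metric
open scoped Topology RealInnerProductSpace Laplacian ContDiff
open Literature.Analysis.FluidPDE
open Summit.NavierStokesRegularity.NavierStokesRegularity.Theorems.PoloidalLiouville.HorizonTower (E3)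
open PointSource

/-- A time-independent field that is `C^n` on `U` is jointly `C^n` on `S ×ˢ U`. -/
theorem contDiffOn_uncurry_const_time {F : Type*} [NormedAddCommGroup F] [NormedSpace ℝ F] {f : E3 → F} {U : Set E3}
    {S : Set ℝ} {n : WithTop ℕ∞} (hf : ContDiffOn ℝ n f U) :
    ContDiffOn ℝ n (uncurry fun (_ : ℝ) (x : E3) => f x) (S ×ˢ U) := by
  have h : (uncurry fun (_ : ℝ) (x : E3) => f x) = f ∘ Prod.snd := by funext p; rfl
  rw [h]
  exact hf.comp contDiffOn_snd fun p hp => hp.2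

/-- **THE ANCIENT KINEMATIC SHADOW IS FALSE ON THE PUNCTURED SPACE.**  `KinematicShadowAncient` (sketch l.151) with its three
drift binders moved to `(−∞,0) × {x₀}ᶜ` (jointly smooth there, divergence free off `x₀`, inverse-square bounded) and every other
binder and the conclusion verbatim, is false: witness = the point-source dipole, constant in time (`x₀ = 0`, `K = 1`, `C = 2`,
axis `e₂`). -/
theorem kinematicShadowAncient_false_without_centre :
    ¬ (∀ (u : ℝ → E3 → E3) (x₀ : E3) (T : ℝ → E3 → ℝ),
        ContDiffOn ℝ (⊤ : ℕ∞) (uncurry u) (Set.Iio 0 ×ˢ ({x₀}ᶜ : Set E3)) →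
        (∀ t < 0, ∀ x, x ≠ x₀ → VectorCalculus.divergence (u t) x = 0) →
        (∃ K : ℝ, ∀ t < 0, ∀ x, x ≠ x₀ → ‖u t x‖ ≤ K / ‖x - x₀‖ ^ 2) →
        ContDiffOn ℝ (⊤ : ℕ∞) (uncurry T) (Set.Iio 0 ×ˢ ({x₀}ᶜ : Set E3)) →
        (∃ C : ℝ, ∀ t < 0, ∀ x, |T t x| ≤ C) →
        (∃ C : ℝ, ∀ t < 0, ∀ x, ‖cross (gradient (T t) x) (x - x₀)‖ ≤ C) →
        (∀ t < 0, ∀ x, x ≠ x₀ →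
          cross (gradient (fun z => deriv (fun s => T s z) t + ⟪u t z, gradient (T t) z⟫
              - Laplacian.laplacian (T t) z) x) (x - x₀) =
            cross (gradient (fun z => ⟪u t z, z - x₀⟫) x) (gradient (T t) x)) →
        ∀ t < 0, ∀ x, cross (gradient (T t) x) (x - x₀) = 0) := by
  intro h
  set e : E3 := EuclideanSpace.single 2 (1 : ℝ) with he
  obtain ⟨_, hdiv, hnorm, _, hTb, hBb, hlaw⟩ := pointSourceDipole e
  have hne : ‖e‖ = 1 := by rw [he, EuclideanSpace.norm_eq]; simp
  have hu : ContDiffOn ℝ (⊤ : ℕ∞) (fun z : E3 => (‖z‖ ^ 3)⁻¹ • z) ({0}ᶜ : Set E3) := contDiffOn_drift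
  have hT : ContDiffOn ℝ (⊤ : ℕ∞)
      (fun z : E3 => ⟪e, z⟫ * (2 - Real.exp (-‖z‖⁻¹) * (‖z‖⁻¹ ^ 2 + 2 * ‖z‖⁻¹ + 2))) ({0}ᶜ : Set E3) :=
    fun x hx => (contDiffAt_potential e hx).contDiffWithinAt
  have h0 := h (fun (_ : ℝ) (z : E3) => (‖z‖ ^ 3)⁻¹ • z) 0
    (fun (_ : ℝ) (z : E3) => ⟪e, z⟫ * (2 - Real.exp (-‖z‖⁻¹) * (‖z‖⁻¹ ^ 2 + 2 * ‖z‖⁻¹ + 2)))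
    (contDiffOn_uncurry_const_time hu) (fun t _ x hx => hdiv x hx)
    ⟨1, fun t _ x hx => by rw [hnorm x hx, sub_zero, one_div]⟩
    (contDiffOn_uncurry_const_time hT) ⟨2, fun t _ x => by simpa [hne] using hTb x⟩
    ⟨2, fun t _ x => by simpa [hne] using hBb x⟩
    (fun t _ x hx => by simpa only [deriv_const, zero_add] using hlaw x hx)
    (-1) (by norm_num) (EuclideanSpace.single 0 (1 : ℝ))
  rw [sub_zero] at h0
  exact field_ne_zero h0

end Summit.NavierStokesRegularity.NavierStokesRegularity.Theorems.PoloidalLiouville.KinematicShadow
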